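import Summits.QuantumFields.YangMills.Theorems.BalabanUVNodesN15KingModelTorusTimeSlices
import HarnessLib

/-!
# BalabanUVNodes ∕ N15 — THE KING-MODEL RUNG (PART Ϲ-c): THE FINITE-η MASS GAP OF KING's FINE FREE FIELD ON THE TORUS AND ITS η-RATE —
# per unit length the zero-momentum timeslice correlator decays at `N·ω₀ = 2N·arsinh(√m²∕(2N))`, and `0 ≤ √m² − N·ω₀ ≤ (√m²)³∕(24N²)`
# (Track A, DAG node N15 = NE2 «η-rates of the covariance pieces»; FAN-OUT v1.1 §N15 s3 «KING-MODEL RUNG»; count-neutral)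

HONEST FRAMING.  Count-neutral (cell `pub-ymgap`, seat `pub-ymgap-dag-n15-e` g38; `--supports stmt-QuantumFields-27366 --as helper` = K3⁸).
TEMPLATE LITERATURE: C. King, Commun. Math. Phys. **102** (1986) 649–677 [King1986] — King's OWN `A = 0` free operator in King's UNITS: on the
fine torus `Ω_η` the operator `Δ^η + m²` is the tree's `lapF K c m²` with `c = η⁻² = N²` ((4.4) p.670, `N = L^k`), so the lattice mass per FINE
step of PART Ϲ-b's zero-momentum channel is `ω₀ = latticeMass(m²∕N²)` and per UNIT (block) length — `N` fine steps — it is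
`N·ω₀ = 2N·arsinh(√m²∕(2N))`: Montvay–Münster's physical mass `m̄₀ = (2∕a)·log((1 + a²m₀²∕4)^{1∕2} + am₀∕2) = m₀{1 + O(a²m₀²)}` ((2.78), (2.82) of
[MontvayMunster1994] §2.2.1, `a = η = 1∕N`).  THIS FILE quantifies the `O(a²m₀²)`: the finite-`η` gap converges to the continuum mass `√m²` —
which IS the exact mass gap `king_massGap_eq = √m²` of the `K = ∞` block field (this seat's PART Ͳ, `…KingModelTransferOperatorExactGap`) — at
RATE `η²` with constant `(√m²)³∕24`, from below.  N15's currency is exactly this: an η-rate of a datum of the covariance.  NOT Bałaban's covariant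
objects; NOT a node discharge (N15 is booked through n15-a's knit, untouched); nothing continuum-YM ∕ ℝ⁴ ∕ OS axioms ∕ Clay.  0 `sorry`, 0 `def`.

WHAT THIS FILE PROVES (kernel).  §1 ★★ `kingGap_le_mass` (`N·ω₀ ≤ √m²`), ★★★ **`mass_sub_kingGap_le`** (`√m² − N·ω₀ ≤ (√m²)³∕(24N²)`),
★★★ **`kingGap_eta_rate`** (both: `0 ≤ √m² − N·latticeMass(m²∕N²) ≤ (√m²)³∕(24·N²)` — THE η-RATE OF THE MASS GAP), `kingGap_pos`,
★★ `tendsto_kingGap` (`N·ω₀ → √m²`), ★ `exp_mass_le_exp_kingGap` (`e^{−√m²·s} ≤ e^{−N·ω₀·s}`, `s ≥ 0`: at finite `η` the free two-point function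
decays SLOWER than in the continuum).  §2 ★★★ **`timeSlice_kingFine_eq_exp`** (King's units: `Σ_{z_κ = t} (N²(−Δ)+m²)⁻¹(z,0) =
(e^{−ω₀r} + e^{−ω₀(n−r)}) ∕ (2N² sinh ω₀ (1 − e^{−ω₀n}))`, `r = val t`, `n = K_κ`), ★★ `timeSlice_kingFine_le_exp` (CLUSTERING on the periodic time
axis: `S(t) ≤ S(0)·(e^{−ω₀r} + e^{−ω₀(n−r)})`), ★★ `timeSlice_kingFine_sub_infinite_le` (TORUS vs INFINITE TIME AXIS: the finite-period correction
`S_n(r) − e^{−ω₀r}∕(2N² sinh ω₀)` lies in `[0, e^{−ω₀(n−r)}∕(N² sinh ω₀(1 − e^{−ω₀n}))]`).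

HONEST SCOPE.  King's `A = 0` free field on a finite torus at fixed `η = 1∕N`; the «mass gap» here is the decay rate of the zero-momentum timeslice
correlator of the FINE field (the RG block field is PART Ϲ-d); no transfer operator is constructed; the `η`-rate constant `1∕24` is the cubic
Taylor coefficient of `arsinh` (`sub_cube_le_arsinh`), not optimal uniformly in `m`.  N15 untouched; counts unmoved.
Locators: [King1986] (4.4) p.670, (2.16)–(2.17) p.653; [MontvayMunster1994] §2.2.1 (2.74)–(2.78), (2.82); [DrouffeZuber1983] (3.43)–(3.46) p.41.
-/

noncomputable section

open scoped BigOperators Topology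
open Finset Matrix Real Filter

namespace Summit.QuantumFields.YangMills.BalabanUVNodes.N15KingModelRung.TorusSpectral

open Literature.MathematicalPhysics.QuantumFieldTheory.Balaban1983to89.B5Prop11Plancherel
open Literature.MathematicalPhysics.QuantumFieldTheory.King1986.Torus

/-! ## §1 The η-rate of the lattice mass in King's units `c = N²` -/

section EtaRate

variable {m2 : ℝ}

/-- `√(m²∕N²) = √m²∕N`. [folklore] -/
theorem sqrt_div_sq_eq {N : ℝ} (hN : 0 < N) (m2 : ℝ) : Real.sqrt (m2 / N ^ 2) = Real.sqrt m2 / N := by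
  rw [Real.sqrt_div' _ (by positivity), Real.sqrt_sq hN.le]

/-- ★★ **`N·ω₀ ≤ √m²`** — the finite-η gap per unit length never exceeds the continuum mass. [cite: MontvayMunster1994, §2.2.1 (2.78), (2.82)] -/
theorem kingGap_le_mass {N : ℝ} (hN : 0 < N) (m2 : ℝ) : N * latticeMass (m2 / N ^ 2) ≤ Real.sqrt m2 := by
  have h := latticeMass_le_sqrt (m2 / N ^ 2)
  rw [sqrt_div_sq_eq hN] at h
  calc N * latticeMass (m2 / N ^ 2) ≤ N * (Real.sqrt m2 / N) := mul_le_mul_of_nonneg_left h hN.le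
    _ = Real.sqrt m2 := mul_div_cancel₀ _ hN.ne'

/-- ★★★ **`√m² − N·ω₀ ≤ (√m²)³∕(24N²)`** — THE η-RATE OF THE MASS GAP (`η = 1∕N`): Montvay–Münster's `m̄₀ = m₀{1 + O(a²m₀²)}` with the constant.
[cite: MontvayMunster1994, §2.2.1 (2.82)] -/
theorem mass_sub_kingGap_le {N : ℝ} (hN : 0 < N) (hm : 0 ≤ m2) :
    Real.sqrt m2 - N * latticeMass (m2 / N ^ 2) ≤ Real.sqrt m2 ^ 3 / (24 * N ^ 2) := by
  have h := sqrt_sub_le_latticeMass (x := m2 / N ^ 2) (by positivity)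
  rw [sqrt_div_sq_eq hN] at h
  have h' := mul_le_mul_of_nonneg_left h hN.le
  have e1 : N * (Real.sqrt m2 / N - (Real.sqrt m2 / N) ^ 3 / 24) = Real.sqrt m2 - Real.sqrt m2 ^ 3 / (24 * N ^ 2) := by
    field_simp
  linarith [e1]

/-- ★★★ **THE η-RATE OF KING's FINITE-η MASS GAP, BOTH SIDES**: `0 ≤ √m² − N·latticeMass(m²∕N²) ≤ (√m²)³∕(24N²)` — the zero-momentum decay rate
per unit length of King's fine free field converges to the continuum mass `√m²` (this seat's `king_massGap_eq` for the `K = ∞` block field) from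
below, at rate `η² = N^{−2}`. [cite: MontvayMunster1994, §2.2.1 (2.78), (2.82); King1986, (4.4) p.670] -/
theorem kingGap_eta_rate {N : ℝ} (hN : 0 < N) (hm : 0 ≤ m2) :
    0 ≤ Real.sqrt m2 - N * latticeMass (m2 / N ^ 2) ∧ Real.sqrt m2 - N * latticeMass (m2 / N ^ 2) ≤ Real.sqrt m2 ^ 3 / (24 * N ^ 2) :=
  ⟨sub_nonneg.mpr (kingGap_le_mass hN m2), mass_sub_kingGap_le hN hm⟩

/-- The finite-η gap is positive for `m² > 0`. [folklore] -/
theorem kingGap_pos {N : ℝ} (hN : 0 < N) (hm : 0 < m2) : 0 < N * latticeMass (m2 / N ^ 2) :=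
  mul_pos hN (latticeMass_pos (by positivity))

/-- ★★ **`N·ω₀(N) → √m²`** as `N → ∞` (`η → 0`): the finite-η mass gap converges to the continuum mass. [cite: MontvayMunster1994, §2.2.1 (2.82)] -/
theorem tendsto_kingGap (hm : 0 ≤ m2) :
    Tendsto (fun N : ℕ => ((N + 1 : ℕ) : ℝ) * latticeMass (m2 / ((N + 1 : ℕ) : ℝ) ^ 2)) atTop (𝓝 (Real.sqrt m2)) := by
  -- squeeze between `√m² − (√m²)³∕(24(N+1)²)` and `√m²`
  have hup : ∀ N : ℕ, ((N + 1 : ℕ) : ℝ) * latticeMass (m2 / ((N + 1 : ℕ) : ℝ) ^ 2) ≤ Real.sqrt m2 :=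
    fun N => kingGap_le_mass (by positivity) m2
  have hlo : ∀ N : ℕ, Real.sqrt m2 - Real.sqrt m2 ^ 3 / (24 * ((N + 1 : ℕ) : ℝ) ^ 2) ≤ ((N + 1 : ℕ) : ℝ) * latticeMass (m2 / ((N + 1 : ℕ) : ℝ) ^ 2) :=
    fun N => by linarith [mass_sub_kingGap_le (N := ((N + 1 : ℕ) : ℝ)) (by positivity) hm]
  have hlim : Tendsto (fun N : ℕ => Real.sqrt m2 - Real.sqrt m2 ^ 3 / (24 * ((N + 1 : ℕ) : ℝ) ^ 2)) atTop (𝓝 (Real.sqrt m2)) := by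
    have h1 : Tendsto (fun N : ℕ => ((N + 1 : ℕ) : ℝ)) atTop atTop := tendsto_natCast_atTop_atTop.comp (tendsto_add_atTop_nat 1)
    have h2 : Tendsto (fun N : ℕ => 24 * ((N + 1 : ℕ) : ℝ) ^ 2) atTop atTop :=
      Tendsto.const_mul_atTop (by norm_num) (tendsto_pow_atTop two_ne_zero |>.comp h1)
    have h3 : Tendsto (fun N : ℕ => Real.sqrt m2 ^ 3 / (24 * ((N + 1 : ℕ) : ℝ) ^ 2)) atTop (𝓝 0) := tendsto_const_nhds.div_atTop h2
    simpa using tendsto_const_nhds.sub h3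
  exact tendsto_of_tendsto_of_tendsto_of_le_of_le hlim tendsto_const_nhds hlo hup

/-- ★ At finite `η` the free two-point function decays SLOWER than in the continuum: `e^{−√m²·s} ≤ e^{−N·ω₀·s}` for `s ≥ 0`. [folklore] -/
theorem exp_mass_le_exp_kingGap {N : ℝ} (hN : 0 < N) (m2 : ℝ) {s : ℝ} (hs : 0 ≤ s) :
    Real.exp (-(Real.sqrt m2 * s)) ≤ Real.exp (-(N * latticeMass (m2 / N ^ 2) * s)) := by
  apply Real.exp_le_exp.mpr
  have := mul_le_mul_of_nonneg_right (kingGap_le_mass hN m2) hs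
  linarith

end EtaRate

/-! ## §2 The fine field's zero-momentum timeslice correlator in King's units -/

section KingUnits

variable {d : ℕ} (K : Fin d → ℕ) [hK : ∀ μ, NeZero (K μ)] (κ : Fin d) (N : ℕ) [NeZero N] {m2 : ℝ}

/-- ★★★ **KING's UNITS: THE ZERO-MOMENTUM TIMESLICE CORRELATOR OF THE FINE FREE FIELD `(N²(−Δ) + m²)⁻¹` IN EXPONENTIAL FORM** —
`Σ_{z : z_κ = t} B⁻¹(z,0) = (e^{−ω₀·r} + e^{−ω₀(n−r)}) ∕ (2N² sinh ω₀ · (1 − e^{−ω₀n}))`, `ω₀ = latticeMass(m²∕N²)`, `r = val t`, `n = K_κ`: the direct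
term decaying at the finite-η mass `ω₀` per fine step (`N·ω₀` per unit length) plus its image around the period.
[cite: King1986, (4.4) p.670; MontvayMunster1994, §2.1.2 (2.24), (2.49), §2.2.1 (2.74)–(2.78)] -/
theorem timeSlice_kingFine_eq_exp (hm : 0 < m2) (t : ZMod (K κ)) :
    ∑ z : Tor K, (if z κ = t then (lapF K ((N : ℝ) ^ 2) m2)⁻¹ z 0 else 0)
      = (Real.exp (-(latticeMass (m2 / (N : ℝ) ^ 2) * t.val)) + Real.exp (-(latticeMass (m2 / (N : ℝ) ^ 2) * (K κ - t.val))))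
          / (2 * (N : ℝ) ^ 2 * Real.sinh (latticeMass (m2 / (N : ℝ) ^ 2)) * (1 - Real.exp (-(latticeMass (m2 / (N : ℝ) ^ 2) * K κ)))) := by
  have hN : (0 : ℝ) < (N : ℝ) ^ 2 := by have := NeZero.ne N; positivity
  rw [timeSlice_lapF_inv_eq_cycleGreen K κ hN hm, cycleGreen_eq_exp, ← div_eq_inv_mul, div_div]
  congr 1
  ring

/-- ★★ **CLUSTERING OF THE FINE FIELD ON THE PERIODIC TIME AXIS**: `S(t) ≤ S(0)·(e^{−ω₀r} + e^{−ω₀(n−r)})`. [cite: DrouffeZuber1983, (3.43) p.41] -/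
theorem timeSlice_kingFine_le_exp (hm : 0 < m2) (t : ZMod (K κ)) :
    ∑ z : Tor K, (if z κ = t then (lapF K ((N : ℝ) ^ 2) m2)⁻¹ z 0 else 0)
      ≤ (∑ z : Tor K, (if z κ = (0 : ZMod (K κ)) then (lapF K ((N : ℝ) ^ 2) m2)⁻¹ z 0 else 0))
          * (Real.exp (-(latticeMass (m2 / (N : ℝ) ^ 2) * t.val)) + Real.exp (-(latticeMass (m2 / (N : ℝ) ^ 2) * (K κ - t.val)))) := by
  have hN : (0 : ℝ) < (N : ℝ) ^ 2 := by have := NeZero.ne N; positivity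
  rw [timeSlice_lapF_inv_eq_cycleGreen K κ hN hm, timeSlice_lapF_inv_eq_cycleGreen K κ hN hm, mul_assoc]
  exact mul_le_mul_of_nonneg_left (cycleGreen_le_exp (K κ) (div_pos hm hN) t) (inv_pos.mpr hN).le

/-- ★★ **TORUS vs INFINITE TIME AXIS FOR THE FINE FIELD**: the finite-period correction of the zero-momentum correlator is NONNEGATIVE and at most ONE
IMAGE, `0 ≤ S_n(r) − e^{−ω₀r}∕(2N² sinh ω₀) ≤ e^{−ω₀(n−r)}∕(N² sinh ω₀ (1 − e^{−ω₀n}))` — exponentially small in the distance `n − r` to the far side of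
the period (the torus-vs-box∕cylinder twin of the timeslice two-point function). [cite: MontvayMunster1994, §2.1.2 (2.24)] -/
theorem timeSlice_kingFine_sub_infinite_le (hm : 0 < m2) (t : ZMod (K κ)) :
    0 ≤ ∑ z : Tor K, (if z κ = t then (lapF K ((N : ℝ) ^ 2) m2)⁻¹ z 0 else 0)
          - Real.exp (-(latticeMass (m2 / (N : ℝ) ^ 2) * t.val)) / (2 * (N : ℝ) ^ 2 * Real.sinh (latticeMass (m2 / (N : ℝ) ^ 2)))
      ∧ ∑ z : Tor K, (if z κ = t then (lapF K ((N : ℝ) ^ 2) m2)⁻¹ z 0 else 0)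
          - Real.exp (-(latticeMass (m2 / (N : ℝ) ^ 2) * t.val)) / (2 * (N : ℝ) ^ 2 * Real.sinh (latticeMass (m2 / (N : ℝ) ^ 2)))
        ≤ Real.exp (-(latticeMass (m2 / (N : ℝ) ^ 2) * (K κ - t.val)))
            / ((N : ℝ) ^ 2 * Real.sinh (latticeMass (m2 / (N : ℝ) ^ 2)) * (1 - Real.exp (-(latticeMass (m2 / (N : ℝ) ^ 2) * K κ)))) := by
  have hN : (0 : ℝ) < (N : ℝ) ^ 2 := by have := NeZero.ne N; positivity
  have hx : 0 < m2 / (N : ℝ) ^ 2 := div_pos hm hN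
  set x := m2 / (N : ℝ) ^ 2
  rw [timeSlice_lapF_inv_eq_cycleGreen K κ hN hm]
  have h1 := exp_le_cycleGreen (K κ) hx t
  have h2 := cycleGreen_sub_exp_le (K κ) hx t
  have e1 : Real.exp (-(latticeMass x * t.val)) / (2 * (N : ℝ) ^ 2 * Real.sinh (latticeMass x))
      = ((N : ℝ) ^ 2)⁻¹ * (Real.exp (-(latticeMass x * t.val)) / (2 * Real.sinh (latticeMass x))) := by
    rw [← div_eq_inv_mul, div_div]; congr 1; ring
  have e2 : Real.exp (-(latticeMass x * (K κ - t.val))) / ((N : ℝ) ^ 2 * Real.sinh (latticeMass x) * (1 - Real.exp (-(latticeMass x * K κ))))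
      = ((N : ℝ) ^ 2)⁻¹ * (Real.exp (-(latticeMass x * (K κ - t.val))) / (Real.sinh (latticeMass x) * (1 - Real.exp (-(latticeMass x * K κ))))) := by
    rw [← div_eq_inv_mul, div_div]; congr 1; ring
  rw [e1, e2, ← mul_sub]
  exact ⟨mul_nonneg (inv_pos.mpr hN).le (sub_nonneg.mpr h1), mul_le_mul_of_nonneg_left h2 (inv_pos.mpr hN).le⟩

end KingUnits

end Summit.QuantumFields.YangMills.BalabanUVNodes.N15KingModelRung.TorusSpectral
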